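import Summits.QuantumAdvantage.QuantumAdvantage.Theorems.AbelianDialC

/-! # AbelianDialD — part 4/5 of the landing twins of NODE «AbelianDial» (decomp-qadv lens-2; node file
`g23/AbelianDial.lean`, sha256 4845a3792d6530ec…; generator `g23/tree/gen_twins.py`: namespace
`Theses.AbelianDial` → `Theorems.AbelianDial`, cut at declaration boundaries, docstrings added where missing, nothing else).
Content: §5 the SPECIAL inhabitant `pmStrat` (parity-mixed twins): `(2,2)`-table-form (`pm_stabTable`), dense (`pm_in_dense_class`),
NOT counter-form at the zero gauge (`pm_not_counterForm_zero`; finite core `pm_core` by `decide`), hence `(2,2) ⊋ (2,1)` (`tableForm22_not_sub_counterForm`). -/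

set_option linter.dupNamespace false
noncomputable section
open scoped Classical

namespace Summit.QuantumAdvantage.QuantumAdvantage.Theorems.AbelianDial
open Finset
open Literature.Computability.QuantumComplexity Literature.Computability.QuantumComplexity.RingHLF
open Literature.Computability.MetaComplexity Literature.Computability.MetaComplexity.Smolensky
open Summit.QuantumAdvantage.AdviceFreeQNC0
open Summit.QuantumAdvantage.QuantumAdvantage.Theorems.AnchorDial (outB dev orbF oddZeros_orbF orbF_apply_of_far
  card_filter_orbF card_odd_ge loss_shape_mono)
open Summit.QuantumAdvantage.QuantumAdvantage.Theorems.HolonomyDial (tPoly tPoly_apply tPoly_mem xorP xorP_mem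
  xorP_apply_bool indP indP_apply indP_mem mono_singleton_apply)
open Summit.QuantumAdvantage.QuantumAdvantage.Theorems.StabilizerDial (apIdx apStrat apStrat_mem bitP bitP_apStrat pad
  pad_mem rel_pad_iff StabFew outB_pad_pad outB_pad_congr bitP_gsum gsum gsum_mem deg_gsum dev_congr)
open Summit.QuantumAdvantage.QuantumAdvantage.Theorems.SparsityDial (real_loss_of_frac stabFew_mono_mr one_le_logpow)
open Summit.QuantumAdvantage.QuantumAdvantage.Theorems.ResponseDial (mem_dev_apStrat dev_pad_zero
  not_polylogSparse_of_agree AddResp additive_loss_count lodd lodd_mem lodd_eq_sum lodd_orbF oddSite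
  oddSite_val oddSite_odd card_exists_orbF_le fibre_le_pow orbF_apply)
open Summit.QuantumAdvantage.QuantumAdvantage.Theorems.CounterDial (bsel mem_iff_bsel)
open Summit.QuantumAdvantage.QuantumAdvantage.Theorems.CounterDial (lin CounterForm StabCounter Dark dw dw_apply_of_far
  oddZeros_dw dark_loss_count)
open Summit.QuantumAdvantage.QuantumAdvantage.Theorems.BlindDial (apIdx_val_first)

variable {N : ℕ}

/-! ## §5  The SPECIAL inhabitant: the parity-mixed TWIN family (abelian of type `(2,2)`, not counter-form)

Position `k` outside the first half-cycle toggles the canonical guess by `[Σ_{i odd} x_i ≡ 0] ⊕ [Σ_{i even} x_i ≡ 0 (mod 3)]`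
— the XOR of TWO counters of different parities (the lineage's standing «twin-XOR» exemplar, NODE-g22 dropped cuts):
a Boolean function of two `Z₃`-linear forms, hence `(2,2)`-table-form, but not a single level set. -/

/-- the EVEN-cell counter `Σ_{i even} x_i ∈ 𝔽₃` (degree 1; the tree's `lodd` is the odd one). -/
def leven : CubeFn (ZMod 3) N := ∑ i ∈ (univ : Finset (Fin N)).filter (fun i => i.val % 2 = 0), mono (ZMod 3) {i}

/-- `leven` (the sum of the even-indexed cells) has degree `≤ 1`. -/
theorem leven_mem : (leven : CubeFn (ZMod 3) N) ∈ lowDeg (ZMod 3) N 1 :=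
  Submodule.sum_mem _ fun _ _ => mono_mem_lowDeg (Finset.card_singleton _).le

/-- `leven x = Σ_{i even} [x_i]` in `Z₃`. -/
theorem leven_eq_sum (x : Fin N → Bool) :
    (leven : CubeFn (ZMod 3) N) x =
      ∑ j ∈ (univ : Finset (Fin N)).filter (fun j => j.val % 2 = 0), (if x j then (1 : ZMod 3) else 0) := by
  unfold leven; rw [Finset.sum_apply]; exact sum_congr rfl fun j _ => mono_singleton_apply j x

/-- a sum over a filter as a full sum with a nested conditional. -/
theorem sum_ite_ite (p : Fin N → Prop) [DecidablePred p] (x : Fin N → Bool) :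
    (∑ i, if x i = true then (if p i then (1 : ZMod 3) else 0) else 0) =
      ∑ i ∈ univ.filter p, (if x i = true then (1 : ZMod 3) else 0) := by
  rw [sum_filter]
  refine sum_congr rfl fun i _ => ?_
  by_cases h1 : x i = true <;> by_cases h2 : p i <;> simp [h1, h2]

/-- the twin gate bit `[Σ_odd ≡ 0] ⊕ [Σ_even ≡ 0]`. -/
def pmBit (y : Fin N → Bool) : Bool :=
  xor (decide ((lodd : CubeFn (ZMod 3) N) y = 0)) (decide ((leven : CubeFn (ZMod 3) N) y = 0))

/-- the twin gate as a polynomial (degree 4). -/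
def pmG : CubeFn (ZMod 3) N := xorP (indP lodd 0) (indP leven 0)

/-- the twin gate polynomial `pmG` has degree `≤ 4`. -/
theorem pmG_mem : (pmG : CubeFn (ZMod 3) N) ∈ lowDeg (ZMod 3) N 4 := by
  have h : (pmG : CubeFn (ZMod 3) N) ∈ lowDeg (ZMod 3) N ((1 + 1) + (1 + 1)) :=
    xorP_mem (indP_mem lodd_mem 0) (indP_mem leven_mem 0)
  exact lowDeg_mono (by norm_num) h

/-- the twin gate polynomial evaluates to the `0/1`-indicator of `pmBit`. -/
theorem pmG_apply (y : Fin N → Bool) : (pmG : CubeFn (ZMod 3) N) y = if pmBit y then 1 else 0 :=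
  xorP_apply_bool _ _ y _ _
    (by rw [indP_apply]; by_cases h : (lodd : CubeFn (ZMod 3) N) y = 0 <;> simp [h])
    (by rw [indP_apply]; by_cases h : (leven : CubeFn (ZMod 3) N) y = 0 <;> simp [h])

/-- **the parity-mixed TWIN family** (degree 6). -/
def pmStrat (k : Fin N) : CubeFn (ZMod 3) N :=
  if 1 ≤ k.val ∧ k.val < N / 2 then apStrat k else xorP (tPoly k) pmG

/-- on the first half-cycle `pmStrat` IS the antipodal pointer `apStrat` (certified density). -/
theorem pmStrat_agree (n : ℕ) (k : Fin n) (h1 : 1 ≤ k.val) (h2 : k.val < n / 2) : pmStrat k = apStrat k := by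
  unfold pmStrat; rw [if_pos ⟨h1, h2⟩]

/-- every `pmStrat k` has degree `≤ 6`. -/
theorem pmStrat_mem6 (k : Fin N) : pmStrat k ∈ lowDeg (ZMod 3) N 6 := by
  unfold pmStrat
  split_ifs
  · exact lowDeg_mono (by norm_num) (apStrat_mem k)
  · exact lowDeg_mono (show 2 + 4 ≤ 6 by norm_num) (xorP_mem (tPoly_mem k) pmG_mem)

/-- the twin family is in the dense class `(c ≥ 1)`. -/
theorem pm_in_dense_class (a c : ℕ) (hc : 1 ≤ c) :
    ∃ n₀ : ℕ, ∀ n ≥ n₀, (∀ i : Fin n, pmStrat i ∈ lowDeg (ZMod 3) n ((Nat.log 2 n) ^ c)) ∧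
      ¬ StabFew ((Nat.log 2 n) ^ a) 0 (c + 1) (fun j : Fin n => pmStrat j) := by
  obtain ⟨n₀, hn₀⟩ := not_polylogSparse_of_agree (fun n (j : Fin n) => pmStrat j)
    (fun n j h1 h2 => pmStrat_agree n j h1 h2) a (c + 1)
  refine ⟨max n₀ 64, fun n hn => ⟨fun i => lowDeg_mono ?_ (pmStrat_mem6 i), hn₀ n (le_trans (le_max_left _ _) hn)⟩⟩
  have h64 : 2 ^ 6 ≤ n := le_trans (le_max_right _ _) hn
  have hL : 6 ≤ Nat.log 2 n := Nat.le_log_of_pow_le (by norm_num) h64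
  calc 6 ≤ Nat.log 2 n := hL
    _ = (Nat.log 2 n) ^ 1 := (pow_one _).symm
    _ ≤ (Nat.log 2 n) ^ c := Nat.pow_le_pow_right (by omega) hc

/-- deviation of the twin family outside the first half-cycle = the twin gate bit. -/
theorem mem_dev_pm_second (y : Fin N → Bool) (k : Fin N) (hk : ¬ (1 ≤ k.val ∧ k.val < N / 2)) :
    k ∈ dev (fun i : Fin N => pmStrat i) y ↔ pmBit y = true := by
  have happ : pmStrat k y = if xor (tGuess y k) (pmBit y) then 1 else 0 := by
    unfold pmStrat; rw [if_neg hk]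
    exact xorP_apply_bool _ _ y _ _ (tPoly_apply k y) (pmG_apply y)
  simp only [Summit.QuantumAdvantage.QuantumAdvantage.Theorems.AnchorDial.dev, mem_filter, mem_univ, true_and, happ]
  generalize tGuess y k = t; generalize pmBit y = q
  cases t <;> cases q <;> decide

/-- deviation of the twin family on the first half-cycle = the antipodal bit. -/
theorem mem_dev_pm_first (y : Fin N → Bool) (k : Fin N) (hk : 1 ≤ k.val ∧ k.val < N / 2) :
    k ∈ dev (fun i : Fin N => pmStrat i) y ↔ y (apIdx k) = true := by
  have h := mem_dev_apStrat y k
  unfold Summit.QuantumAdvantage.QuantumAdvantage.Theorems.AnchorDial.dev at h ⊢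
  rw [mem_filter] at h ⊢
  have e : (fun i : Fin N => pmStrat i) k y = (fun i : Fin N => apStrat i) k y := by
    show pmStrat k y = apStrat k y; rw [pmStrat_agree N k hk.1 hk.2]
  rw [e]; exact h

/-! ### (a) the twin family IS `(2,2)`-table-form (at the zero gauge): the special piece's class is inhabited -/

/-- coefficient table: the pointer positions read one cell, the twin positions read `(Σ_odd, Σ_even)`. -/
def pmV (k i : Fin N) (j : Fin 2) : ZMod 3 :=
  if 1 ≤ k.val ∧ k.val < N / 2 then (if j.val = 0 ∧ i = apIdx k then 1 else 0)
  else (if j.val = 0 then (if i.val % 2 = 1 then 1 else 0) else (if i.val % 2 = 0 then 1 else 0))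

/-- the tables: `[w₀ = 1]` at pointer positions, `[w₀ = 0] ⊕ [w₁ = 0]` at twin positions. -/
def pmT (k : Fin N) (w : Fin 2 → ZMod 3) : Bool :=
  if 1 ≤ k.val ∧ k.val < N / 2 then decide (w 0 = 1) else xor (decide (w 0 = 0)) (decide (w 1 = 0))

/-- **the twin family is `(2,2)`-table-form at the zero gauge.** -/
theorem pm_tableForm : TableForm 2 2 pmV pmT (pad (fun i : Fin N => pmStrat i) (fun _ => 0)) := by
  intro x _ k
  rw [dev_pad_zero]
  by_cases hk : 1 ≤ k.val ∧ k.val < N / 2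
  · rw [mem_dev_pm_first x k hk]
    have e0 : alin 2 2 (pmV k) x 0 = if x (apIdx k) = true then 1 else 0 := by
      unfold alin
      rw [Finset.sum_eq_single (apIdx k)]
      · simp [pmV, hk]
      · intro i _ hi; simp [pmV, hk, hi]
      · intro h; exact absurd (mem_univ _) h
    unfold pmT; rw [if_pos hk, e0]
    generalize x (apIdx k) = bb; cases bb <;> decide
  · rw [mem_dev_pm_second x k hk]
    have e0 : alin 2 2 (pmV k) x 0 = (lodd : CubeFn (ZMod 3) N) x := by
      rw [lodd_eq_sum, ← sum_ite_ite]; unfold alin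
      refine sum_congr rfl fun i _ => ?_; simp [pmV, hk]
    have e1 : alin 2 2 (pmV k) x 1 = (leven : CubeFn (ZMod 3) N) x := by
      rw [leven_eq_sum, ← sum_ite_ite]; unfold alin
      refine sum_congr rfl fun i _ => ?_; simp [pmV, hk]
    unfold pmT pmBit; rw [if_neg hk, e0, e1]

/-- hence the twin family is cheaply `(2,2)`-table-form (zero gauge, any `e`). -/
theorem pm_stabTable (e : ℕ) : StabTable 2 2 e (fun i : Fin N => pmStrat i) :=
  ⟨fun _ => 0, fun _ => Submodule.zero_mem _, pmV, pmT, pm_tableForm⟩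

/-! ### (b) the twin family is NOT counter-form at the zero gauge

A single `Z₃`-linear form cannot reproduce `[Σ_odd ≡ 0] ⊕ [Σ_even ≡ 0]`: by PIGEONHOLE five odd cells share a coefficient `α`
and five even cells share a coefficient `β`; on inputs supported there the form reads `p·α + q·β` (`p`, `q` = the numbers
of ones of each parity), the zero-parity constraint fixes `p + q (mod 2)`, every residue pair `(p, q) (mod 3)` occurs with
either parity for `p, q ≤ 5`, and `[p ≡ 0] ⊕ [q ≡ 0]` is not a function of `p·α + q·β (mod 3)` — a `9·16`-case core.
(Five LOCAL cells do not suffice: under the parity constraint the twin gate coincides there with `[Σ_odd − Σ_even ≢ 0]`;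
`decide` refuted that first core — recorded in the memo.) -/

/-- the linear form `lin v` at the indicator vector `indB S` equals the sum of `v` over `S`. -/
theorem lin_indB (v : Fin N → ZMod 3) (S : Finset (Fin N)) : lin v (indB S) = ∑ i ∈ S, v i := by
  unfold Summit.QuantumAdvantage.QuantumAdvantage.Theorems.CounterDial.lin indB
  simp only [decide_eq_true_eq]
  rw [← Finset.sum_filter]
  congr 1
  ext i; simp

/-- `lodd` at the indicator input of `S` is the number of odd cells in `S` (in `Z₃`). -/
theorem lodd_indB (S : Finset (Fin N)) :
    (lodd : CubeFn (ZMod 3) N) (indB S) = (((univ.filter fun i : Fin N => i.val % 2 = 1) ∩ S).card : ZMod 3) := by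
  rw [lodd_eq_sum]
  have e : ∀ j : Fin N, (if indB S j = true then (1 : ZMod 3) else 0) = if j ∈ S then 1 else 0 := fun j => by
    simp only [indB, decide_eq_true_eq]
  simp_rw [e]
  rw [Finset.sum_ite_mem, sum_const, nsmul_eq_mul, mul_one]

/-- `leven` at the indicator input of `S` is the number of even cells in `S` (in `Z₃`). -/
theorem leven_indB (S : Finset (Fin N)) :
    (leven : CubeFn (ZMod 3) N) (indB S) = (((univ.filter fun i : Fin N => i.val % 2 = 0) ∩ S).card : ZMod 3) := by
  rw [leven_eq_sum]
  have e : ∀ j : Fin N, (if indB S j = true then (1 : ZMod 3) else 0) = if j ∈ S then 1 else 0 := fun j => by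
    simp only [indB, decide_eq_true_eq]
  simp_rw [e]
  rw [Finset.sum_ite_mem, sum_const, nsmul_eq_mul, mul_one]

/-- **the twin core** (a finite check by `decide`): for all coefficients `α, β`, every residue set and either parity,
some `p, q ≤ 5` of the prescribed parity separate `[p ≡ 0] ⊕ [q ≡ 0]` from `[p·α + q·β ∈ A]`. -/
theorem pm_core : ∀ α β : ZMod 3, ∀ A₀ A₁ A₂ P : Bool, ∃ p q : Fin 6,
    decide ((p.val + q.val) % 2 = 1) = P ∧
      (xor (decide ((p.val : ZMod 3) = 0)) (decide ((q.val : ZMod 3) = 0))) ≠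
        bsel A₀ A₁ A₂ ((p.val : ZMod 3) * α + (q.val : ZMod 3) * β) := by
  decide

/-- thirteen cells of each parity below `26`. -/
theorem card_parity_cells (hN : 26 ≤ N) (r : ℕ) (hr : r < 2) :
    12 < (univ.filter fun i : Fin N => i.val % 2 = r).card := by
  have hinj : Function.Injective fun j : Fin 13 => (⟨2 * j.val + r, by omega⟩ : Fin N) := fun j j' h => by
    have h1 := congrArg Fin.val h; exact Fin.ext (by dsimp only at h1; omega)
  have h13 : (univ.image fun j : Fin 13 => (⟨2 * j.val + r, by omega⟩ : Fin N)).card = 13 := by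
    rw [card_image_of_injective _ hinj, card_univ, Fintype.card_fin]
  have hsub : (univ.image fun j : Fin 13 => (⟨2 * j.val + r, by omega⟩ : Fin N)) ⊆
      univ.filter fun i : Fin N => i.val % 2 = r := by
    intro i hi
    obtain ⟨j, -, rfl⟩ := mem_image.1 hi
    rw [mem_filter]; exact ⟨mem_univ _, by simp only; omega⟩
  have := card_le_card hsub
  omega

/-- **the twin family is NOT in counter form at the zero gauge** (`N ≥ 26`). -/
theorem pm_not_counterForm (hN : 26 ≤ N) (a : Fin N → Fin N → ZMod 3) (A : Fin N → Finset (ZMod 3)) :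
    ¬ CounterForm a A (pad (fun i : Fin N => pmStrat i) (fun _ => 0)) := by
  intro hF
  set k₀ : Fin N := ⟨N - 1, by omega⟩ with hk₀
  have hk : ¬ (1 ≤ k₀.val ∧ k₀.val < N / 2) := by simp only [hk₀]; omega
  set OddC : Finset (Fin N) := univ.filter fun i : Fin N => i.val % 2 = 1 with hOddC
  set EvC : Finset (Fin N) := univ.filter fun i : Fin N => i.val % 2 = 0 with hEvC
  have hOc : 12 < OddC.card := card_parity_cells hN 1 (by norm_num)
  have hEc : 12 < EvC.card := card_parity_cells hN 0 (by norm_num)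
  -- pigeonhole: five odd cells with a common coefficient, five even cells with a common coefficient
  obtain ⟨α, -, hα⟩ := exists_lt_card_fiber_of_mul_lt_card_of_maps_to (s := OddC) (t := (univ : Finset (ZMod 3)))
    (f := a k₀) (n := 4) (fun _ _ => mem_univ _) (by rw [card_univ, ZMod.card]; omega)
  obtain ⟨β, -, hβ⟩ := exists_lt_card_fiber_of_mul_lt_card_of_maps_to (s := EvC) (t := (univ : Finset (ZMod 3)))
    (f := a k₀) (n := 4) (fun _ _ => mem_univ _) (by rw [card_univ, ZMod.card]; omega)
  obtain ⟨p, q, hpq, hne⟩ := pm_core α β (decide ((0 : ZMod 3) ∈ A k₀)) (decide ((1 : ZMod 3) ∈ A k₀))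
    (decide ((2 : ZMod 3) ∈ A k₀)) (decide ((N + 1) % 2 = 1))
  obtain ⟨Uo, hUo, hUoc⟩ := exists_subset_card_eq (s := OddC.filter fun x => a k₀ x = α) (n := p.val) (by omega)
  obtain ⟨Ue, hUe, hUec⟩ := exists_subset_card_eq (s := EvC.filter fun x => a k₀ x = β) (n := q.val) (by omega)
  have hUo_odd : ∀ i ∈ Uo, i.val % 2 = 1 := fun i hi => by
    have h := hUo hi; rw [mem_filter, hOddC, mem_filter] at h; exact h.1.2
  have hUo_v : ∀ i ∈ Uo, a k₀ i = α := fun i hi => by have h := hUo hi; rw [mem_filter] at h; exact h.2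
  have hUe_ev : ∀ i ∈ Ue, i.val % 2 = 0 := fun i hi => by
    have h := hUe hi; rw [mem_filter, hEvC, mem_filter] at h; exact h.1.2
  have hUe_v : ∀ i ∈ Ue, a k₀ i = β := fun i hi => by have h := hUe hi; rw [mem_filter] at h; exact h.2
  have hdisj : Disjoint Uo Ue := disjoint_left.2 fun i h1 h2 => by
    have := hUo_odd i h1; have := hUe_ev i h2; omega
  set U : Finset (Fin N) := Uo ∪ Ue with hU
  have hUcard : U.card = p.val + q.val := by rw [hU, card_union_of_disjoint hdisj, hUoc, hUec]
  have hOU : OddC ∩ U = Uo := by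
    ext i; rw [mem_inter, hU, mem_union]
    constructor
    · rintro ⟨h1, h2 | h2⟩
      · exact h2
      · exfalso; rw [hOddC, mem_filter] at h1; have := hUe_ev i h2; omega
    · intro h; exact ⟨by rw [hOddC, mem_filter]; exact ⟨mem_univ _, hUo_odd i h⟩, Or.inl h⟩
  have hEU : EvC ∩ U = Ue := by
    ext i; rw [mem_inter, hU, mem_union]
    constructor
    · rintro ⟨h1, h2 | h2⟩
      · exfalso; rw [hEvC, mem_filter] at h1; have := hUo_odd i h2; omega
      · exact h2
    · intro h; exact ⟨by rw [hEvC, mem_filter]; exact ⟨mem_univ _, hUe_ev i h⟩, Or.inr h⟩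
  -- the test input: ones exactly on `U`
  have hodd : OddZeros (indB U) := by
    rw [oddZeros_indB, hUcard]
    have hpq' := decide_eq_decide.1 hpq
    have h10 : p.val + q.val ≤ 10 := by omega
    by_cases hNp : (N + 1) % 2 = 1
    · have := hpq'.2 hNp; omega
    · have : ¬ ((p.val + q.val) % 2 = 1) := fun h => hNp (hpq'.1 h); omega
  have hlodd : (lodd : CubeFn (ZMod 3) N) (indB U) = (p.val : ZMod 3) := by rw [lodd_indB, ← hOddC, hOU, hUoc]
  have hleven : (leven : CubeFn (ZMod 3) N) (indB U) = (q.val : ZMod 3) := by rw [leven_indB, ← hEvC, hEU, hUec]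
  have hlin : lin (a k₀) (indB U) = (p.val : ZMod 3) * α + (q.val : ZMod 3) * β := by
    rw [lin_indB, hU, sum_union hdisj, sum_congr rfl hUo_v, sum_congr rfl hUe_v, sum_const, sum_const, hUoc, hUec,
      nsmul_eq_mul, nsmul_eq_mul]
  have h := hF (indB U) hodd k₀
  rw [dev_pad_zero, mem_dev_pm_second _ k₀ hk] at h
  unfold pmBit at h
  rw [hlodd, hleven, hlin, mem_iff_bsel] at h
  exact hne (by rw [Bool.eq_iff_iff]; exact h)

/-- hence, for `N ≥ 26`, the twin family is not counter-form AT THE ZERO GAUGE: it inhabits B's class and the special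
piece's class `(2,2)` (§5(a)) simultaneously. -/
theorem pm_not_counterForm_zero (hN : 26 ≤ N) :
    ¬ ∃ (a : Fin N → Fin N → ZMod 3) (A : Fin N → Finset (ZMod 3)),
      CounterForm a A (pad (fun i : Fin N => pmStrat i) (fun _ => 0)) := by
  rintro ⟨a, A, h⟩; exact pm_not_counterForm hN a A h

/-- hence type `(2,2)` is STRICTLY larger than counter form (= type `(2,1)`, §2) already at the level of forms: the
gauge-free inclusion «`(2,2)`-table-form ⟹ counter-form» FAILS for `N ≥ 26` (witness: the twin family at the zero
gauge).  This is the decided half of the honest scope of F15/C18 in `bc/Probe.lean`. -/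
theorem tableForm22_not_sub_counterForm (hN : 26 ≤ N) :
    ¬ ∀ Q : Fin N → CubeFn (ZMod 3) N,
      (∃ (v : Fin N → Fin N → Fin 2 → ZMod 3) (G : Fin N → (Fin 2 → ZMod 3) → Bool), TableForm 2 2 v G Q) →
        ∃ (a : Fin N → Fin N → ZMod 3) (A : Fin N → Finset (ZMod 3)), CounterForm a A Q :=
  fun h => pm_not_counterForm_zero hN (h _ ⟨pmV, pmT, pm_tableForm⟩)

end Summit.QuantumAdvantage.QuantumAdvantage.Theorems.AbelianDial
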